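import Summits.Langlands.Langlands.Theses.SteinbergArtinDedekind
import Literature.NumberTheory.GaloisRepresentations.SteinbergArtinRep
import HarnessLib

/-!
# `SteinbergArtinDedekind.SteinbergArtinExists` (stmt-Langlands-11806) — by citation

The support item stmt-Langlands-11806 of route `SteinbergArtinDedekind` asks, for every prime `ℓ` and every mod-`ℓ`
Galois representation `ρ̄ : Γ_ℚ → GL₂(𝔽_ℓ)`, for a complex Artin representation `σ : Γ_ℚ → GL_ℓ(ℂ)` with
`tr σ(g) = #{w ≠ 0 : ρ̄(g) w ∈ 𝔽_ℓ w}/(ℓ − 1) − 1` — the character of the Steinberg representation of `GL₂(𝔽_ℓ)`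
composed with `ρ̄`.  The accepted Literature module `Literature/NumberTheory/GaloisRepresentations/SteinbergArtinRep.lean`
constructs exactly this (`steinbergArtinRep ℓ ρ̄ = St_ℓ ∘ ρ̄`, `steinbergArtin_exists`, over any number field `K`);
this file closes the item BY NAME by citing that theorem at `K = ℚ` (decomp-langlands lens-6 g42 extra #7, re-landed as
the critic's one-liner per CRITIC-LEDGER row 558: reuse the existing declaration instead of re-developing it).
Nothing here proves `Langlands`; the item is a support leaf (rank 9), out of the cone of the route's deciding theorem.
-/

set_option linter.dupNamespace false -- project-wide option; `Summit.Langlands.Langlands` is the mandated namespace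

namespace Summit.Langlands.Langlands.Theorems.SteinbergArtinDedekindSteinbergArtinExists

open Summit.Langlands.Langlands.Theses.SteinbergArtinDedekind in
/-- **stmt-Langlands-11806** `SteinbergArtinExists`: the Steinberg–Artin representation `St_ℓ ∘ ρ̄` exists with the
prescribed character, by the Literature witness `Literature.NumberTheory.GaloisRepresentations.steinbergArtin_exists`
(SteinbergArtinRep.lean:466) at `K = ℚ`. [folklore] -/
theorem steinbergArtinExists : SteinbergArtinExists :=
  fun ℓ _ ρ => Literature.NumberTheory.GaloisRepresentations.steinbergArtin_exists ℓ ρ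

end Summit.Langlands.Langlands.Theorems.SteinbergArtinDedekindSteinbergArtinExists
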